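import Literature.Algebra.Lie.ChevalleyEilenbergComplex
import HarnessLib

/-!
# Chevalley–Eilenberg complex: Cartan's homotopy formula, trivial action on cohomology, `H¹`

Topic `Algebra/Lie`; namespace `Literature.Algebra.Lie.ChevalleyEilenberg` (consequences of
`ChevalleyEilenbergComplex`).  Theorems and (section `DegreeZero`) definitions with bodies; no
named fact, no `sorry`.

* `lieDer_eq_ins_d_add_d_ins` — **Cartan's homotopy formula** `θ_x = i_x d + d i_x`
  [cite: BorelWallach2000, I §1.1 (5)] ((23.6) of [cite: ChevalleyEilenberg1948, §23]
  rearranged), and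
  `lieDer_zero_eq_ins_d` in degree `0`;
* `lieDer_mem_coboundaries`, `toCohomology_lieDer_eq_zero` — hence **`L` acts trivially on
  `H^•(L; M)`**: `θ_x` of a cocycle is the coboundary `d (i_x f)`;
* `d_one_eq_zero_iff`, `eq_d_zero_iff`, `mem_cocycles_one_iff`, `mem_coboundaries_one_iff` —
  **`H¹(L; M) = Der(L, M) / InnDer(L, M)`**: `1`-cocycles are the derivations (crossed
  homomorphisms) `f(⁅x, y⁆) = ⁅x, f(y)⁆ - ⁅y, f(x)⁆`, `1`-coboundaries the inner derivations
  `x ↦ ⁅x, m⁆` [cite: Weibel1994, Thm. 7.4.7];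
* `lieDer_apply` — the closed formula `(θ_x f)(v) = x • f(v) - Σᵢ f(…, [x, vᵢ], …)`
  [cite: BorelWallach2000, I §1.1 (3)]; `d_succ_apply_cons` — first-variable expansion of `d`
  (Cartan's recursion with the closed `θ`); `d_two_apply` — `d` in degree `2` as printed
  [cite: BorelWallach2000, I §1.1 (2)];
* `Subcomplex.cohomologyZeroEquiv` (`H⁰(S) ≃ Z⁰(S)`), `const`, `Subcomplex.invariants`,
  `Subcomplex.cocyclesZeroEquiv`, `Subcomplex.cohomologyZeroEquivInvariants` —
  **`H⁰(S) ≃ S.invariants = {m | const m ∈ S₀, ⁅x, m⁆ = 0 ∀ x}`** (`H⁰(𝔤, 𝔨; V) = V^𝔤`,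
  [cite: BorelWallach2000, I §1.2 (3)]).

## References

* A. Borel, N. Wallach (2000), I §1.1 (5) [BorelWallach2000].
* C. Chevalley, S. Eilenberg, Trans. AMS 63 (1948), §23 (23.6) [ChevalleyEilenberg1948].
* C. Weibel, *An introduction to homological algebra* (1994), Def. 7.4.3, Ex. 7.4.4, Thm. 7.4.7
  (held) [Weibel1994].
-/

open Fin Function

namespace Literature.Algebra.Lie

namespace ChevalleyEilenberg

variable {R : Type*} [CommRing R] {L : Type*} [LieRing L] [LieAlgebra R L]
  {M : Type*} [AddCommGroup M] [Module R M]

/-! ### Consequences: Cartan homotopy formula, `L` acts trivially on cohomology; `H¹` -/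

section Consequences

variable [LieRingModule L M] [LieModule R L M]

/-- **Cartan's homotopy formula** `θ_x = i_x d + d i_x` on `C^{q+1}` (Borel–Wallach I.1.1 (5);
Chevalley–Eilenberg (23.6) rearranged). [cite: BorelWallach2000, I §1.1 (5)] -/
theorem lieDer_eq_ins_d_add_d_ins (q : ℕ) (x : L) (f : Cochain R L M (q + 1)) :
    lieDer R L M (q + 1) x f = ins (q + 1) x (d R L M (q + 1) f) + d R L M q (ins q x f) := by
  rw [ins_d_succ, sub_add_cancel]

/-- In degree `0`: `θ_x f = i_x (d f)`. [cite: ChevalleyEilenberg1948, §23 (23.1)] -/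
theorem lieDer_zero_eq_ins_d (x : L) (f : Cochain R L M 0) :
    lieDer R L M 0 x f = ins 0 x (d R L M 0 f) :=
  (ins_d_zero x f).symm

/-- **`L` acts trivially on its cohomology**: for a cocycle `f` of the full complex, `θ_x f` is a
coboundary (`θ_x f = d (i_x f)`), in every degree. [cite: BorelWallach2000, I §1.1 (5)] -/
theorem lieDer_mem_coboundaries {q : ℕ} (x : L) {f : Cochain R L M q}
    (hf : f ∈ (Subcomplex.top R L M).cocycles q) :
    lieDer R L M q x f ∈ (Subcomplex.top R L M).coboundaries q := by
  rw [Subcomplex.mem_cocycles_iff] at hf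
  cases q with
  | zero =>
    rw [lieDer_zero_eq_ins_d, hf.2, map_zero]
    exact Submodule.zero_mem _
  | succ q =>
    rw [lieDer_eq_ins_d_add_d_ins, hf.2, map_zero, zero_add]
    exact (Subcomplex.mem_coboundaries_succ_iff _ q _).2 ⟨ins q x f, trivial, rfl⟩

/-- The class of `θ_x f` vanishes: the action of `L` on `H^q(L; M)` induced by `θ` is zero.
[cite: BorelWallach2000, I §1.1 (5)] -/
theorem toCohomology_lieDer_eq_zero {q : ℕ} (x : L) (f : Cochain R L M q)
    (hf : f ∈ (Subcomplex.top R L M).cocycles q)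
    (hθf : lieDer R L M q x f ∈ (Subcomplex.top R L M).cocycles q) :
    (Subcomplex.top R L M).toCohomology q ⟨lieDer R L M q x f, hθf⟩ = 0 :=
  ((Subcomplex.top R L M).toCohomology_eq_zero_iff q _).2 (lieDer_mem_coboundaries x hf)

/-- **`1`-cocycles are derivations (crossed homomorphisms)**: `d f = 0` iff
`f(⁅x, y⁆) = ⁅x, f(y)⁆ - ⁅y, f(x)⁆` for all `x, y`. [cite: Weibel1994, Def. 7.4.3] -/
theorem d_one_eq_zero_iff (f : Cochain R L M 1) :
    d R L M 1 f = 0 ↔ ∀ x y : L, f ![⁅x, y⁆] = ⁅x, f ![y]⁆ - ⁅y, f ![x]⁆ := by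
  constructor
  · intro h x y
    have e := d_one_apply (R := R) f x y
    rw [h, AlternatingMap.zero_apply] at e
    -- `0 = ⁅x, f y⁆ - ⁅y, f x⁆ - f ⁅x, y⁆`
    exact (sub_eq_zero.1 e.symm).symm
  · intro h
    refine ext_ins fun x => ext_ins fun y => ?_
    rw [map_zero, map_zero]
    ext v
    have hv : v = ![] := Subsingleton.elim _ _
    subst hv
    have e := d_one_apply (R := R) f x y
    rw [h x y, sub_self] at e
    change d R L M 1 f ![x, y] = 0
    exact e

/-- **`1`-coboundaries are inner derivations**: `f = d m` iff `f(x) = ⁅x, m⁆` for the vector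
`m = m()`. [cite: Weibel1994, Ex. 7.4.4] -/
theorem eq_d_zero_iff (f : Cochain R L M 1) (m : Cochain R L M 0) :
    f = d R L M 0 m ↔ ∀ x : L, f ![x] = ⁅x, m ![]⁆ := by
  constructor
  · rintro rfl x
    exact d_zero_apply_one m x
  · intro h
    refine ext_ins fun x => ?_
    ext v
    have hv : v = ![] := Subsingleton.elim _ _
    subst hv
    rw [ins_apply, ins_d_zero, lieDer_zero_apply]
    exact h x

/-- `H¹(L; M) = Der(L, M) / InnDer(L, M)`: membership in the `1`-cocycles and `1`-coboundaries of
the full complex, unfolded.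
[cite: Weibel1994, Thm. 7.4.7] -/
theorem mem_cocycles_one_iff (f : Cochain R L M 1) :
    f ∈ (Subcomplex.top R L M).cocycles 1 ↔
      ∀ x y : L, f ![⁅x, y⁆] = ⁅x, f ![y]⁆ - ⁅y, f ![x]⁆ := by
  rw [Subcomplex.mem_cocycles_iff, d_one_eq_zero_iff]
  exact ⟨fun h => h.2, fun h => ⟨trivial, h⟩⟩

/-- `1`-coboundaries are the inner derivations `x ↦ ⁅x, m⁆`, `m ∈ M`.
[cite: Weibel1994, Thm. 7.4.7] -/
theorem mem_coboundaries_one_iff (f : Cochain R L M 1) :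
    f ∈ (Subcomplex.top R L M).coboundaries 1 ↔ ∃ m : M, ∀ x : L, f ![x] = ⁅x, m⁆ := by
  rw [Subcomplex.mem_coboundaries_succ_iff]
  constructor
  · rintro ⟨g, -, hg⟩
    refine ⟨g ![], fun x => ?_⟩
    rw [← hg]
    exact d_zero_apply_one g x
  · rintro ⟨m, hm⟩
    refine ⟨AlternatingMap.constOfIsEmpty R L (Fin 0) m, trivial, ?_⟩
    refine ((eq_d_zero_iff f _).2 fun x => ?_).symm
    rw [hm x]
    rfl

end Consequences

/-! ### Degree zero: `H⁰(S)` is the space of invariants cut out by `S` -/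

section DegreeZero

variable [LieRingModule L M] [LieModule R L M]

/-- In degree `0` there are no coboundaries: `H⁰(S) ≃ Z⁰(S)`. [folklore] -/
def Subcomplex.cohomologyZeroEquiv (S : Subcomplex R L M) : S.Cohomology 0 ≃ₗ[R] S.cocycles 0 :=
  Submodule.quotEquivOfEqBot _ (by
    change (⊥ : Submodule R (Cochain R L M 0)).comap (S.cocycles 0).subtype = ⊥
    rw [Submodule.comap_bot, Submodule.ker_subtype])

/-- `cohomologyZeroEquiv [z] = z`. [folklore] -/
@[simp]
theorem Subcomplex.cohomologyZeroEquiv_toCohomology (S : Subcomplex R L M) (z : S.cocycles 0) :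
    S.cohomologyZeroEquiv (S.toCohomology 0 z) = z := rfl

/-- The `0`-cochain with value `m` (a `0`-cochain is a constant). [folklore] -/
abbrev const (m : M) : Cochain R L M 0 := AlternatingMap.constOfIsEmpty R L (Fin 0) m

omit [LieRingModule L M] [LieModule R L M] in
/-- `const m v = m`. [folklore] -/
@[simp] theorem const_apply (m : M) (v : Fin 0 → L) : const (R := R) m v = m := rfl

omit [LieRingModule L M] [LieModule R L M] in
/-- Every `0`-cochain is the constant with its value at the empty tuple. [folklore] -/
theorem const_apply_empty (f : Cochain R L M 0) : const (f ![]) = f := by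
  ext v
  rw [const_apply, show v = ![] from Subsingleton.elim _ _]

/-- **The invariants cut out by a subcomplex in degree `0`**: the values `m ∈ M` whose constant
`0`-cochain lies in `S₀` and is a cocycle (`⁅x, m⁆ = 0` for all `x ∈ L`).
[cite: BorelWallach2000, I §1.2 (3)] -/
def Subcomplex.invariants (S : Subcomplex R L M) : Submodule R M where
  carrier := {m | const m ∈ S.carrier 0 ∧ ∀ x : L, ⁅x, m⁆ = 0}
  add_mem' {a b} ha hb := by
    refine ⟨?_, fun x => by rw [lie_add, ha.2 x, hb.2 x, add_zero]⟩
    have e : const (R := R) (L := L) (a + b) = const a + const b := by ext; rfl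
    rw [e]
    exact Submodule.add_mem _ ha.1 hb.1
  zero_mem' := by
    refine ⟨?_, fun x => lie_zero x⟩
    have e : const (R := R) (L := L) (0 : M) = 0 := by ext; rfl
    rw [e]
    exact Submodule.zero_mem _
  smul_mem' c m hm := by
    refine ⟨?_, fun x => by rw [lie_smul, hm.2 x, smul_zero]⟩
    have e : const (R := R) (L := L) (c • m) = c • const m := by ext; rfl
    rw [e]
    exact Submodule.smul_mem _ c hm.1

/-- Membership in `S.invariants`. [folklore] -/
theorem Subcomplex.mem_invariants_iff (S : Subcomplex R L M) (m : M) :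
    m ∈ S.invariants ↔ const m ∈ S.carrier 0 ∧ ∀ x : L, ⁅x, m⁆ = 0 := Iff.rfl

/-- `Z⁰(S) ≃ S.invariants` by evaluation at the empty tuple. [folklore] -/
def Subcomplex.cocyclesZeroEquiv (S : Subcomplex R L M) : S.cocycles 0 ≃ₗ[R] S.invariants where
  toFun z := ⟨(z : Cochain R L M 0) ![], by
    have hz := (mem_cocycles_zero_iff S _).1 z.2
    refine ⟨?_, fun x => hz.2 x ![]⟩
    rw [const_apply_empty]
    exact hz.1⟩
  map_add' z w := rfl
  map_smul' c z := rfl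
  invFun m := ⟨const (m : M), (mem_cocycles_zero_iff S _).2 ⟨m.2.1, fun x v => by
    rw [const_apply]; exact m.2.2 x⟩⟩
  left_inv z := by
    ext1
    exact const_apply_empty _
  right_inv m := by
    ext1
    rfl

/-- Forward map = evaluation at `![]`. [folklore] -/
@[simp] theorem Subcomplex.coe_cocyclesZeroEquiv (S : Subcomplex R L M) (z : S.cocycles 0) :
    (S.cocyclesZeroEquiv z : M) = (z : Cochain R L M 0) ![] := rfl

/-- Backward map = constant cochain. [folklore] -/
@[simp] theorem Subcomplex.coe_cocyclesZeroEquiv_symm (S : Subcomplex R L M) (m : S.invariants) :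
    ((S.cocyclesZeroEquiv.symm m : S.cocycles 0) : Cochain R L M 0) = const (m : M) := rfl

/-- **`H⁰(S) ≃ S.invariants`** (`H⁰(𝔤, 𝔨; V) = V^𝔤`, `H⁰(𝔤, K; V) = V^{𝔤, K}`).
[cite: BorelWallach2000, I §1.2 (3)] -/
def Subcomplex.cohomologyZeroEquivInvariants (S : Subcomplex R L M) :
    S.Cohomology 0 ≃ₗ[R] S.invariants :=
  S.cohomologyZeroEquiv.trans S.cocyclesZeroEquiv

end DegreeZero

/-! ### Closed formula for `θ`, first-variable expansion of `d`, degree `2` -/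

section Formulas

variable [LieRingModule L M] [LieModule R L M]

/-- **Closed formula for the Lie derivative** (Borel–Wallach I.1.1 (3)):
`(θ_x f)(v₀, …, v_{q-1}) = x • f(v) - Σᵢ f(v₀, …, [x, vᵢ], …, v_{q-1})`.
[cite: BorelWallach2000, I §1.1 (3)] -/
theorem lieDer_apply (q : ℕ) (x : L) (f : Cochain R L M q) (v : Fin q → L) :
    lieDer R L M q x f v = ⁅x, f v⁆ - ∑ i, f (Function.update v i ⁅x, v i⁆) := by
  induction q with
  | zero => simp
  | succ q ih =>
    have hv : v = Fin.cons (v 0) (Fin.tail v) := (Fin.cons_self_tail v).symm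
    rw [hv]
    set y := v 0
    set w := Fin.tail v
    have e := congrArg (fun φ : Cochain R L M q => φ w) (ins_lieDer (R := R) (M := M) q x y f)
    simp only [ins_apply, AlternatingMap.sub_apply] at e
    change lieDer R L M (q + 1) x f (Fin.cons y w) = _
    have e' : lieDer R L M (q + 1) x f (Fin.cons y w) =
        lieDer R L M q x (ins q y f) w - f (Matrix.vecCons ⁅x, y⁆ w) := e
    rw [e', ih, Fin.sum_univ_succ]
    simp only [ins_apply, Fin.cons_zero, Fin.update_cons_zero, Fin.cons_succ]
    have hupd : ∀ i : Fin q, (Matrix.vecCons y (Function.update w i ⁅x, w i⁆) : Fin (q + 1) → L) =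
        Function.update (Fin.cons y w : Fin (q + 1) → L) i.succ ⁅x, w i⁆ := fun i => by
      rw [← Fin.cons_update]; rfl
    simp only [hupd]
    have hc : (Matrix.vecCons ⁅x, y⁆ w : Fin (q + 1) → L) = Fin.cons ⁅x, y⁆ w := rfl
    have hcons : (Matrix.vecCons y w : Fin (q + 1) → L) = Fin.cons y w := rfl
    rw [hc, hcons]
    abel

/-- **First-variable expansion of the differential** (Cartan's recursion unfolded with the closed
formula for `θ`): `(d f)(y, w) = y • f(w) - Σᵢ f(w₀, …, [y, wᵢ], …) - (d (i_y f))(w)`.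
[cite: ChevalleyEilenberg1948, §23 (23.6)] -/
theorem d_succ_apply_cons (q : ℕ) (f : Cochain R L M (q + 1)) (y : L) (w : Fin (q + 1) → L) :
    d R L M (q + 1) f (Fin.cons y w) =
      ⁅y, f w⁆ - ∑ i, f (Function.update w i ⁅y, w i⁆) - d R L M q (ins q y f) w := by
  have e := congrArg (fun φ : Cochain R L M (q + 1) => φ w) (ins_d_succ (R := R) (M := M) q y f)
  simp only [ins_apply, AlternatingMap.sub_apply] at e
  rw [← lieDer_apply]
  exact e

/-- **The differential in degree `2`**:
`(d f)(x, y, z) = x•f(y,z) - y•f(x,z) + z•f(x,y) - f([x,y],z) + f([x,z],y) - f([y,z],x)`.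
[cite: BorelWallach2000, I §1.1 (2)] -/
theorem d_two_apply (f : Cochain R L M 2) (x y z : L) :
    d R L M 2 f ![x, y, z] =
      ⁅x, f ![y, z]⁆ - ⁅y, f ![x, z]⁆ + ⁅z, f ![x, y]⁆
        - f ![⁅x, y⁆, z] + f ![⁅x, z⁆, y] - f ![⁅y, z⁆, x] := by
  have h := d_succ_apply_cons (R := R) (M := M) 1 f x ![y, z]
  have h0 : (Fin.cons x ![y, z] : Fin 3 → L) = ![x, y, z] := by
    ext i; fin_cases i <;> rfl
  rw [h0] at h
  rw [h, Fin.sum_univ_two, d_one_apply]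
  simp only [ins_apply, Matrix.cons_val_zero, Matrix.cons_val_one]
  have u0 : Function.update (![y, z] : Fin 2 → L) 0 ⁅x, y⁆ = ![⁅x, y⁆, z] := by
    ext i; fin_cases i <;> rfl
  have u1 : Function.update (![y, z] : Fin 2 → L) 1 ⁅x, z⁆ = ![y, ⁅x, z⁆] := by
    ext i; fin_cases i <;> rfl
  rw [u0, u1]
  have s1 : f ![y, ⁅x, z⁆] = - f ![⁅x, z⁆, y] := by
    rw [← AlternatingMap.map_swap f ![⁅x, z⁆, y] (i := 0) (j := 1) (by decide)]
    congr 1; ext i; fin_cases i <;> rfl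
  have s2 : (Matrix.vecCons x ![z] : Fin 2 → L) = ![x, z] := rfl
  have s3 : (Matrix.vecCons x ![y] : Fin 2 → L) = ![x, y] := rfl
  have s4 : (Matrix.vecCons x ![⁅y, z⁆] : Fin 2 → L) = ![x, ⁅y, z⁆] := rfl
  simp only [s2, s3, s4, s1]
  have s5 : f ![x, ⁅y, z⁆] = - f ![⁅y, z⁆, x] := by
    rw [← AlternatingMap.map_swap f ![⁅y, z⁆, x] (i := 0) (j := 1) (by decide)]
    congr 1; ext i; fin_cases i <;> rfl
  rw [s5]
  abel

end Formulas

end ChevalleyEilenberg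

end Literature.Algebra.Lie
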